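import Literature.Computability.Cryptography.RegevReductionFinal
import Literature.Algebra.EuclideanLattices.RegevIterationParameters
import Literature.Probability.Distributions.IndepProductLawDistance
import Literature.Computability.QuantumComplexity.StageChains
import HarnessLib

/-!
# Regev 2009, Theorem 3.1 in machine form: the loop of the printed proof, reduced to its stages

Topic `Computability/Cryptography` (family `pqc`), grouping namespace `Regev2009`. Running tally of
the discharge of the named facts `Literature.Computability.Cryptography.regev_lwe_to_sivp_quantum`
and `…regev_lwe_to_gapSVP_quantum` (pqc.S19; Regev, J. ACM 56 (2009), Thm 1.1). After
`LWEAmplification.lean` (the average-case bridge `h₁` PROVED) both assemblies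
(`regev_lwe_to_sivp_quantum_of_thm31_of_lemma317`, `regev_lwe_to_gapSVP_quantum_of_thm31_of_lemma320`)
share ONE remaining quantum hypothesis `h₂`: **Theorem 3.1 in machine form** — from a uniform
quantum family `W` solving search-`LWE_{q,Ψ̄_α}` for every secret (`SolvesSearchLWEWorstCase`), for
every negligible `ε > 0` a uniform quantum family `D` sampling `DGS_{√(2n)·η_ε(L)/α}` up to a
negligible statistical distance (`SamplesDGS`).

This file formalises **the proof of Theorem 3.1 itself** (author's version arXiv:2401.03703,
p. 15): *"Let `rᵢ` denote `r·(αp/√n)ⁱ`. The algorithm starts by producing `n^c` samples from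
`D_{L,r_{3n}}` … by the procedure described in the bootstrapping lemma [Lemma 3.2, needs
`r_{3n} > 2^{2n}λₙ(L)`]. Next, for `i = 3n, 3n-1, …, 1` we use our `n^c` samples from `D_{L,rᵢ}` to
produce `n^c` samples from `D_{L,r_{i-1}}` [the iterative step, Lemma 3.3, needs
`rᵢ > √2 p η_ε(L)`] … we end up with `n^c` samples from `D_{L,r₀} = D_{L,r}` and we complete the
algorithm by simply outputting the first of those"* — as a PROVED reduction
(`Regev2009.thm_3_1_machine_of_stages`) of `h₂` to two machine-level hypotheses with exact Lean
interfaces: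

* `hLoop` — **iterated composition of a uniform family** (generic; Bernstein–Vazirani 1997, §8,
  classical control inside quantum machines; Nielsen–Chuang 2010, §4.4, principle of deferred
  measurement): for every uniform family `S` and polynomials `T`, `m` there is a uniform family `D`
  which, on input `x`, runs the chain `y₀ = []`, `y_{k+1} ∼ (S on ⟨x, ⟨1ᵏ, y_k⟩⟩)` read through a
  window of exactly `m(|x|)` wires (first `m` bits, zero-padded), `k < T(|x|)`, and carries the
  last stage's register as a PREFIX of its measured
  register, in law (`QuantumComplexity.chainLaw`, `StageChains.lean`; stated as the one-sided event inequality that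
  the tree's wrapper theorems deliver, cf. `CWrap.kernelProb_family_ge`). To be proved in
  `QuantumComplexity/` as a combinator (stage blocks side by side, inputs assembled by `CNOT`
  fan-out, the last block swapped to the front; uniformity by a counted loop over `k`).
* `hStage` — **Lemmas 3.2 and 3.3 in machine form, realised by one stage family `S` dispatching on
  the stage counter** (same binders as `h₂`): stage `0` (input `⟨x, ⟨1⁰, []⟩⟩`, `x = encode (B, r)`)
  writes, at the front of its register, the code of a batch of `N(n)` vectors whose law is within
  `ν_S(n)` of `D_{L(B),ρ₀}^{⊗N}` whenever `2^{2n}λₙ(L(B)) < ρ₀` (Lemma 3.2, composed with the schedule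
  `r ↦ ρ₀ = θ_n^{3n}·r`); stage `k+1`, `k < 3n` (input `⟨x, ⟨1^{k+1}, y⟩⟩`, `y` carrying a batch at
  radius `ρ_k`) outputs a batch at radius `ρ_{k+1} = ρ_k/θ_n`, the distance to the ideal batch law
  growing by at most `ν_S(n)` whenever `√2·q·η_ε(L(B)) < ρ_k` (Lemma 3.3: its classical half Lemma 3.4
  with the oracle `W`, its quantum half Lemma 3.14; the contraction form along the chain is what a
  data-processing argument through the step yields); the stages `k+1 > 3n`, which a circuit indexed
  by the input LENGTH `|x| ≥ n` also runs (`3|x|+1` stages in all), pass the batch on at no cost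
  (`ρ_k = r` for `k ≥ 3n`). The ratio `θ_n ≥ α_n q_n/√n` is the stage's own choice (Regev:
  `θ = αp/√n` exactly; a machine in exact arithmetic takes a rational `θ_n`, e.g.
  `α_n q_n/⌊√n⌋ ≤ (8/5)·α_n q_n/√n` for `n ≥ 8`, `div_sqrt_le_div_natSqrt`, `div_natSqrt_le`, which
  the slack of Lemma 3.14 — Banaszczyk's tail at radius `0.6√n` instead of `√n` — absorbs). Batches
  travel in a prefix-unique code `encB` placed at the front of the stage's register, whose strings
  decode under the tree's reader `decodeLatticeVector` (the reader of `SamplesDGS`) to the first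
  vector of the batch ("outputting the first of those").

What is PROVED here (no named fact is introduced; `hLoop`, `hStage` are binders):

* (on the chains `chainLaw 0 S.family m x k` of `QuantumComplexity/StageChains.lean`) `Regev2009.readFront` (the classical reader of a front code, for
  prefix-unique codes: `readFront_append`, `readFront_of_prefix`), `readBatchE`, `idealBatch`
  (`= (D_{L,ρ}^{⊗N}).map some`), `levelRadius t L r k = t^{L-k}·r`;
* the admissibility of every paying stage under `φ(B) = √(2n)η_ε(L(B))/α < r` for ANY ratio
  `θ_n ≥ α_n q_n/√n` (from the tree's `RegevIterationParameters.lean`, Regev's own arithmetic, by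
  `regevRadius_le_levelRadius`): `Regev2009.sqrt_two_mul_lt_levelRadius` (`√2 q η_ε < ρ_k`, `k < 3n`)
  and `Regev2009.two_pow_mul_successiveMinimum_lt_levelRadius_zero` (`2^{2n}λₙ < ρ₀`, `ε ≤ e^{-π}`);
  `n_le_length_encode_pair` (`n ≤ |encode (B, r)|`);
* the induction along the chain (`Regev2009.le_add_sum_of_succ_le`, `sum_range_ite_lt`: after the
  `3|x|+1` stages the decoded batch is within `(3n+1)·ν_S(n)` of `D_{L,r}^{⊗N}`), the first marginal
  (`LWE.iidPMF_map_eval`), and the read-out through the prefix relation of `hLoop`;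
* **`Regev2009.thm_3_1_machine_of_stages hLoop hStage : h₂`** with `ν(n) = (3n+1)·ν_S(n)`, and the
  corollaries `regev_lwe_to_sivp_quantum_of_stages_of_lemma317`,
  `regev_lwe_to_gapSVP_quantum_of_stages_of_lemma320` (pqc.S19 from `hLoop`, `hStage` and
  Lemma 3.17, resp. Lemma 3.20, in machine form).

## References

* O. Regev, *On lattices, learning with errors, random linear codes, and cryptography*, J. ACM 56
  (2009), art. 34; author's version arXiv:2401.03703: Theorem 3.1 and its proof (p. 15), Lemmas 3.2,
  3.3, 3.4, 3.14, Claim 2.13, §2 p. 11 ("a model that approximates real numbers") [Regev2009].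
* E. Bernstein, U. Vazirani, *Quantum complexity theory*, SIAM J. Comput. 26 (1997), §8
  [BernsteinVazirani1997].
* M. A. Nielsen, I. L. Chuang, *Quantum Computation and Quantum Information*, CUP 2010, §4.4
  (principle of deferred measurement) [NielsenChuang2010].
* O. Goldreich, *Foundations of Cryptography* I, CUP 2001, §3.2.1–3.2.2 (statistical distance under
  randomised maps) [Goldreich2001].
-/

noncomputable section

open Filter Asymptotics Literature.Computability.Complexity Literature.Computability.Cryptography.LWE
  Literature.Algebra.EuclideanLattices Literature.Algebra.EuclideanLattices.Regev2009
  Literature.Computability.QuantumComplexity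
open scoped ENNReal

namespace Literature.Computability.Cryptography

namespace Regev2009

/-! ### Front codes and their classical reader -/

section FrontCode

variable {β : Type*} (enc : β → List Bool)

/-- The classical reader of a code placed at the FRONT of a string: `some b` if `enc b` is a prefix
of `z` (a well-defined `b` for prefix-unique codes, `readFront_eq_some`), `none` otherwise. A
specification device (laws of decoded registers); machines parse the code themselves.
[Arora–Barak 2009, §0.1 (self-delimiting codes)] [folklore] -/
def readFront (z : List Bool) : Option β :=
  open Classical in if h : ∃ b, enc b <+: z then some (Classical.choose h) else none

/-- A read value is a front code of the string. [folklore] -/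
theorem prefix_of_readFront_eq_some {z : List Bool} {b : β} (h : readFront enc z = some b) :
    enc b <+: z := by
  classical
  unfold readFront at h
  split_ifs at h with h'
  cases h
  exact Classical.choose_spec h'

/-- For a prefix-unique code, a string starting with `enc b` reads `b`. [folklore] -/
theorem readFront_eq_some (huniq : ∀ b b' (z : List Bool), enc b <+: z → enc b' <+: z → b = b')
    {z : List Bool} {b : β} (h : enc b <+: z) : readFront enc z = some b := by
  classical
  unfold readFront
  have h' : ∃ b, enc b <+: z := ⟨b, h⟩
  rw [dif_pos h']
  exact congrArg some (huniq _ _ _ (Classical.choose_spec h') h)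

/-- `enc b ++ w` reads `b`. [folklore] -/
theorem readFront_append (huniq : ∀ b b' (z : List Bool), enc b <+: z → enc b' <+: z → b = b')
    (b : β) (w : List Bool) : readFront enc (enc b ++ w) = some b :=
  readFront_eq_some enc huniq (List.prefix_append _ _)

/-- Reading is stable under extension of the string. [folklore] -/
theorem readFront_of_prefix (huniq : ∀ b b' (z : List Bool), enc b <+: z → enc b' <+: z → b = b')
    {y z : List Bool} (hyz : y <+: z) {b : β} (h : readFront enc y = some b) :
    readFront enc z = some b :=
  readFront_eq_some enc huniq ((prefix_of_readFront_eq_some enc h).trans hyz)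

end FrontCode

/-! ### Batches of lattice vectors -/

/-- An integer batch as a tuple of vectors of `ℝⁿ`. [folklore] -/
def batchToE (n N : ℕ) (b : Fin N → Fin n → ℤ) : Fin N → EuclideanSpace ℝ (Fin n) :=
  fun j => intVecToEuclidean n (b j)

/-- The batch of real vectors read off the front of a string (`none` if no batch code is there).
[folklore] -/
def readBatchE {n N : ℕ} (enc : (Fin N → Fin n → ℤ) → List Bool) (z : List Bool) :
    Option (Fin N → EuclideanSpace ℝ (Fin n)) :=
  (readFront enc z).map (batchToE n N)

/-- The ideal law of a stage's batch: `N` independent samples of `D_{L(B),ρ}` (pushed into `ℝⁿ`),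
tagged `some`. [cite: Regev2009, Theorem 3.1 (proof: "n^c samples from D_{L,rᵢ}")] -/
def idealBatch (I : LatticeInstance) (N : ℕ) (ρ : ℝ) :
    PMF (Option (Fin N → EuclideanSpace ℝ (Fin I.n))) :=
  (iidPMF ((discreteGaussian I.lattice ρ 0).map Subtype.val) N).map some

/-! ### The radii of the loop -/

/-- The radius of the batch produced by stage `k` of a loop with `L` iterative steps and ratio `t`
on input radius `r`: `ρ_k = t^{L-k} · r` (`ρ₀ = t^L r` for the bootstrap, `ρ_L = r` at the end;
Regev's `rᵢ = r(αp/√n)ⁱ` is `ρ_{L-i}` with `t = αp/√n`, `L = 3n`; a circuit family indexed by the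
input LENGTH runs `L = 3|x| ≥ 3n` steps). [cite: Regev2009, Theorem 3.1 (proof, "rᵢ = r·(αp/√n)ⁱ")] -/
def levelRadius (t : ℝ) (L : ℕ) (r : ℝ) (k : ℕ) : ℝ :=
  t ^ (L - k) * r

/-- At the end of the loop the radius is `r`. [cite: Regev2009, Theorem 3.1 (proof: "D_{L,r₀} = D_{L,r}")] -/
@[simp] theorem levelRadius_end (t : ℝ) (L : ℕ) (r : ℝ) : levelRadius t L r L = r := by
  simp [levelRadius]

/-- Regev's radii are below ours: `rᵢ ≤ ρ_k` whenever `i ≤ L - k` and `αp/√n ≤ t` (`αp/√n ≥ 1`,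
`r ≥ 0`). [folklore] -/
theorem regevRadius_le_levelRadius {t α : ℝ} {p n : ℕ} (hratio : 1 ≤ α * p / Real.sqrt n)
    (ht : α * p / Real.sqrt n ≤ t) {r : ℝ} (hr : 0 ≤ r) {i L k : ℕ} (hi : i ≤ L - k) :
    regevRadius r α p n i ≤ levelRadius t L r k := by
  rw [regevRadius, levelRadius, mul_comm]
  refine mul_le_mul_of_nonneg_right ?_ hr
  exact (pow_le_pow_right₀ hratio hi).trans
    (pow_le_pow_left₀ (zero_le_one.trans hratio) ht _)

/-- The input `⟨B, r⟩` of a `DGS` sampler is at least as long as the dimension: `n ≤ |encode (B, r)|`.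
[folklore] -/
theorem n_le_length_encode_pair (I : LatticeInstance) (r : ℚ) :
    I.n ≤ (GapSVPInstance.encode (I, r)).length := by
  have h : GapSVPInstance.encode (I, r) = boolPair I.encode (encodeRat r) := rfl
  rw [h, length_boolPair]
  have := I.n_le_length_encode
  omega

/-- **Admissibility of every iterative step** (Lemma 3.3 needs `r' > √2 q η_ε(L)`): for
`φ(B) = √(2n) η/α < r`, `0 < α`, `αq > 2√n`, `n ≥ 1`, `t ≥ α q/√n` and `k < L`, `√2 q η < ρ_k`.
[cite: Regev2009, Theorem 3.1 (proof: "for all i ≥ 1, rᵢ ≥ r₁ = rαp/√n > √2 p η_ε(L)")] -/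
theorem sqrt_two_mul_lt_levelRadius {t r α η : ℝ} {p n : ℕ} (hα : 0 < α) (hn : 0 < n)
    (hαp : 2 * Real.sqrt n < α * p) (ht : α * p / Real.sqrt n ≤ t) (hη : 0 ≤ η)
    (hr : Real.sqrt (2 * n) * η / α < r) {L k : ℕ} (hk : k < L) :
    Real.sqrt 2 * p * η < levelRadius t L r k := by
  have hr0 : 0 < r := lt_of_le_of_lt (div_nonneg (mul_nonneg (Real.sqrt_nonneg _) hη) hα.le) hr
  have hratio : 1 ≤ α * p / Real.sqrt n := by linarith [two_lt_ratio hn hαp]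
  exact (sqrt_two_mul_mul_lt_regevRadius hα hn hαp hη hr le_rfl).trans_le
    (regevRadius_le_levelRadius hratio ht hr0.le (by omega))

/-- **Admissibility of the bootstrap** (Lemma 3.2 needs `r' > 2^{2n} λₙ(L)`): for a nonsingular
instance `B` of dimension `n ≥ 1`, `φ(B) < r`, `0 < α < 1`, `αq > 2√n`, `0 < ε ≤ e^{-π}`,
`t ≥ α q/√n` and `L ≥ 3n` iterative steps, `2^{2n} λₙ(L(B)) < ρ₀ = t^L r`.
[cite: Regev2009, Theorem 3.1 (proof: "by Claim 2.13, r_{3n} > 2^{3n} r > 2^{2n} λₙ(L)")] -/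
theorem two_pow_mul_successiveMinimum_lt_levelRadius_zero {t : ℝ} {I : LatticeInstance}
    (hI : I.IsNonsingular) (hn : 0 < I.n) {r α ε : ℝ} {p : ℕ} (hα : 0 < α) (hα1 : α < 1)
    (hαp : 2 * Real.sqrt I.n < α * p) (hε : 0 < ε) (hεπ : ε ≤ Real.exp (-Real.pi))
    (ht : α * p / Real.sqrt I.n ≤ t)
    (hr : Real.sqrt (2 * I.n) * smoothingParameter I.lattice ε / α < r) {L : ℕ} (hL : 3 * I.n ≤ L) :
    2 ^ (2 * I.n) * successiveMinimum I.lattice I.n < levelRadius t L r 0 := by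
  haveI := LatticeInstance.isZLattice_of_isNonsingular hI
  haveI : Nontrivial (EuclideanSpace ℝ (Fin I.n)) :=
    Module.nontrivial_of_finrank_pos (R := ℝ) (by rw [finrank_euclideanSpace_fin]; exact hn)
  have h := two_pow_mul_successiveMinimum_lt_regevRadius (L := I.lattice) (p := p) hα hα1
    (by rwa [finrank_euclideanSpace_fin]) hε hεπ (by rwa [finrank_euclideanSpace_fin])
  rw [finrank_euclideanSpace_fin] at h
  have hη : 0 ≤ smoothingParameter I.lattice ε := smoothingParameter_nonneg _ _
  have hr0 : 0 < r := lt_of_le_of_lt (div_nonneg (mul_nonneg (Real.sqrt_nonneg _) hη) hα.le) hr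
  have hratio : 1 ≤ α * p / Real.sqrt I.n := by linarith [two_lt_ratio hn hαp]
  exact h.trans_le (regevRadius_le_levelRadius hratio ht hr0.le (by omega))

/-- A rational choice of the ratio dominates Regev's: `αq/√n ≤ αq/⌊√n⌋` (`n ≥ 1`, `αq ≥ 0`).
[folklore] -/
theorem div_sqrt_le_div_natSqrt {a : ℝ} (ha : 0 ≤ a) {n : ℕ} (hn : 0 < n) :
    a / Real.sqrt n ≤ a / Nat.sqrt n := by
  have hs : (0 : ℝ) < Nat.sqrt n := by exact_mod_cast Nat.sqrt_pos.2 hn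
  exact div_le_div_of_nonneg_left ha hs (Real.nat_sqrt_le_real_sqrt (a := n))

/-- … and exceeds it by a factor `≤ 8/5` once `n ≥ 8` (`⌊√n⌋ ≥ √n - 1 ≥ (5/8)√n`). [folklore] -/
theorem div_natSqrt_le {a : ℝ} (ha : 0 ≤ a) {n : ℕ} (hn : 8 ≤ n) :
    a / Nat.sqrt n ≤ 8 / 5 * (a / Real.sqrt n) := by
  have hn0 : 0 < n := by omega
  have hs : (0 : ℝ) < Nat.sqrt n := by exact_mod_cast Nat.sqrt_pos.2 hn0
  have hsq : 0 < Real.sqrt n := Real.sqrt_pos.2 (by exact_mod_cast hn0)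
  -- `√n < ⌊√n⌋ + 1`
  have h1 : Real.sqrt n < Nat.sqrt n + 1 := by
    have hlt : (n : ℝ) < ((Nat.sqrt n + 1 : ℕ) : ℝ) ^ 2 := by exact_mod_cast Nat.lt_succ_sqrt' n
    have := Real.sqrt_lt_sqrt (Nat.cast_nonneg n) hlt
    rwa [Real.sqrt_sq (by positivity), Nat.cast_add, Nat.cast_one] at this
  -- `√n ≥ √8 > 8/3`, so `√n - 1 ≥ (5/8)√n`
  have h8 : (8 : ℝ) / 3 ≤ Real.sqrt n := by
    rw [Real.le_sqrt (by norm_num) (Nat.cast_nonneg n)]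
    have : (8 : ℝ) ≤ n := by exact_mod_cast hn
    nlinarith
  have h2 : 5 / 8 * Real.sqrt n ≤ Nat.sqrt n := by linarith
  rw [mul_div_assoc', div_le_div_iff₀ hs hsq]
  nlinarith

/-! ### The induction along the chain -/

/-- **The loop invariant** (arithmetic form): if `a₀ ≤ ν` and `a_{k+1} ≤ a_k + c_k` for `k < K`, then
`a_k ≤ ν + ∑_{j<k} c_j` for `k ≤ K` (triangle inequality along the chain, Goldreich 2001, §3.2.2).
[cite: Regev2009, Theorem 3.1 (proof: the loop)] -/
theorem le_add_sum_of_succ_le {a c : ℕ → ℝ} {ν : ℝ} {K : ℕ} (h0 : a 0 ≤ ν)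
    (h : ∀ k < K, a (k + 1) ≤ a k + c k) {k : ℕ} (hk : k ≤ K) :
    a k ≤ ν + ∑ j ∈ Finset.range k, c j := by
  induction k with
  | zero => simpa using h0
  | succ k ih =>
    rw [Finset.sum_range_succ]
    have hk' : k < K := Nat.lt_of_succ_le hk
    linarith [h k hk', ih hk'.le]

/-- The cost of the loop: `M` paying stages among `L ≥ M`. [folklore] -/
theorem sum_range_ite_lt (a : ℝ) {M L : ℕ} (h : M ≤ L) :
    ∑ j ∈ Finset.range L, (if j < M then a else 0) = M * a := by
  obtain ⟨d, rfl⟩ := Nat.exists_eq_add_of_le h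
  induction d with
  | zero =>
    rw [Nat.add_zero, Finset.sum_congr rfl fun j hj => if_pos (Finset.mem_range.1 hj),
      Finset.sum_const, Finset.card_range, nsmul_eq_mul]
  | succ d ih =>
    rw [← Nat.add_assoc, Finset.sum_range_succ, ih (Nat.le_add_right _ _), if_neg (by omega),
      add_zero]

/-! ### Theorem 3.1 in machine form from the loop principle and the stage family -/

section MainTheorem

variable (q : ℕ → ℕ) [∀ n, NeZero (q n)] (α : ℕ → ℝ)

/-- **Regev 2009, Theorem 3.1 (machine form `h₂`) from its stages.** Given

* `hLoop`, the iterated-composition principle for uniform quantum families (the last string of the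
  chain `chainLaw 0 S.family m x T` is, in law, a prefix of the register of one uniform
  family `D` run on `x`), and
* `hStage`, ONE uniform stage family `S` realising, under the hypotheses of Thm 3.1, the bootstrap
  (Lemma 3.2 at radius `ρ₀ = θ^{3n} r`, stage `0`) and the iterative step (Lemma 3.3, stage `k+1`
  for `k < 3n`: radius `ρ_k ↦ ρ_{k+1} = ρ_k/θ`, as a contraction of the distance to the ideal batch
  law up to `ν_S(n)`; stages `k+1 > 3n`, which a circuit indexed by the input length `|x| ≥ n` also
  runs, pass the batch on at no cost) for some ratio `θ_n ≥ α_n q_n/√n`, batch size `N(n) ≥ 1`,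
  truncation polynomial `m_S`, prefix-unique batch code `encB` whose strings decode
  (`decodeLatticeVector`) to the first vector of the batch, and negligible error `ν_S`,

the family `D := hLoop S (3X+1) m_S` samples `DGS_{√(2n)η_ε(L)/α}` up to `ν(n) = (3n+1)·ν_S(n)`:
on `(B, r)` with `φ(B) < r` every paying stage is admissible
(`two_pow_mul_successiveMinimum_lt_levelRadius_zero`, `sqrt_two_mul_lt_levelRadius`), the decoded
batch after the `3|x|+1` stages is within `(3n+1)ν_S` of `D_{L(B),r}^{⊗N}` (`le_add_sum_of_succ_le`,
`sum_range_ite_lt`, `ρ_k = r` for `k ≥ 3n`), and the first vector of the last batch is what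
`decodeLatticeVector` reads off `D`'s register (prefix relation of `hLoop`, `prefix_of_readFront_eq_some`).
[cite: Regev2009, Theorem 3.1 (proof, p. 15)] -/
theorem thm_3_1_machine_of_stages
    (hLoop : ∀ (S : UniformQCircuitFamily) (T m : Polynomial ℕ), ∃ D : UniformQCircuitFamily,
      ∀ (x : List Bool) (E : Set (List Bool)),
        (chainLaw 0 S.family (m.eval x.length) x (T.eval x.length)).toOuterMeasure E ≤
          (D.kernel x).toOuterMeasure {z | ∃ y ∈ E, y <+: z})
    (hStage : ∀ (m : ℕ → ℕ) (_ : IsPolyBounded m) (_ : IsPolyTimeParams q α m)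
      (_ : ∀ᶠ n : ℕ in atTop, 0 < α n ∧ α n < 1 ∧ 2 * Real.sqrt n < α n * q n)
      (_ : ∃ (W : UniformQCircuitFamily) (c : ℝ), 0 < c ∧
        W.SolvesSearchLWEWorstCase q (fun n => discretizedGaussian (q n) (α n)) m
          fun n => (2 : ℝ) ^ (-(c * n)))
      (ε : ℕ → ℝ), IsNegligible ε → (∀ n, 0 < ε n) →
      ∃ (S : UniformQCircuitFamily) (N : ℕ → ℕ) (mS : Polynomial ℕ)
        (encB : (n : ℕ) → (Fin (N n) → Fin n → ℤ) → List Bool) (νS : ℕ → ℝ) (θ : ℕ → ℝ),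
        IsNegligible νS ∧ (∀ n, 0 < n → α n * q n / Real.sqrt n ≤ θ n) ∧
        (∀ n (b b' : Fin (N n) → Fin n → ℤ) (z : List Bool), encB n b <+: z → encB n b' <+: z → b = b') ∧
        (∀ n (b : Fin (N n) → Fin n → ℤ) (w : List Bool) (j : Fin (N n)), (j : ℕ) = 0 →
          decodeLatticeVector n (encB n b ++ w) = b j) ∧
        (∀ n, 0 < N n) ∧
        ∀ᶠ n : ℕ in atTop, ∀ (I : LatticeInstance) (r : ℚ) (x : List Bool), I.n = n → I.IsNonsingular →
          x = GapSVPInstance.encode (I, r) →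
          ((2 : ℝ) ^ (2 * I.n) * successiveMinimum I.lattice I.n < levelRadius (θ I.n) (3 * I.n) r 0 →
            ((chainLaw 0 S.family (mS.eval x.length) x 1).map (readBatchE (encB I.n))).tvDist
              (idealBatch I (N I.n) (levelRadius (θ I.n) (3 * I.n) r 0)) ≤ νS I.n) ∧
          (∀ k, k < 3 * x.length →
            (k < 3 * I.n → Real.sqrt 2 * q I.n * smoothingParameter I.lattice (ε I.n) <
              levelRadius (θ I.n) (3 * I.n) r k) →
            ((chainLaw 0 S.family (mS.eval x.length) x (k + 2)).map (readBatchE (encB I.n))).tvDist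
                (idealBatch I (N I.n) (levelRadius (θ I.n) (3 * I.n) r (k + 1))) ≤
              ((chainLaw 0 S.family (mS.eval x.length) x (k + 1)).map (readBatchE (encB I.n))).tvDist
                  (idealBatch I (N I.n) (levelRadius (θ I.n) (3 * I.n) r k)) +
                if k < 3 * I.n then νS I.n else 0)) :
    ∀ (m : ℕ → ℕ) (_ : IsPolyBounded m) (_ : IsPolyTimeParams q α m)
      (_ : ∀ᶠ n : ℕ in atTop, 0 < α n ∧ α n < 1 ∧ 2 * Real.sqrt n < α n * q n)
      (_ : ∃ (W : UniformQCircuitFamily) (c : ℝ), 0 < c ∧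
        W.SolvesSearchLWEWorstCase q (fun n => discretizedGaussian (q n) (α n)) m
          fun n => (2 : ℝ) ^ (-(c * n)))
      (ε : ℕ → ℝ), IsNegligible ε → (∀ n, 0 < ε n) →
      ∃ (D : UniformQCircuitFamily) (ν : ℕ → ℝ), IsNegligible ν ∧ D.SamplesDGS (regevDGSBound α ε) ν := by
  intro m hm hpar hreg hW ε hε hε0
  obtain ⟨S, N, mS, encB, νS, θ, hνS, hθ, huniq, hdec, hN, hst⟩ := hStage m hm hpar hreg hW ε hε hε0
  -- the loop family: `3|x| + 1` stages (the bootstrap and `3|x| ≥ 3n` iterative steps)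
  set T : Polynomial ℕ := Polynomial.C 3 * Polynomial.X + 1 with hT
  have hTe : ∀ n : ℕ, T.eval n = 3 * n + 1 := fun n => by simp [hT]
  obtain ⟨D, hD⟩ := hLoop S T mS
  refine ⟨D, fun n => ((3 * n + 1 : ℕ) : ℝ) * νS n, ?_, ?_⟩
  · -- negligibility of `(3n+1) ν_S`
    have h := hνS.polynomial_mul (Polynomial.C 3 * Polynomial.X + 1 : Polynomial ℝ)
    have e : (fun n : ℕ => ((3 * n + 1 : ℕ) : ℝ) * νS n) =
        fun n : ℕ => (Polynomial.C 3 * Polynomial.X + 1 : Polynomial ℝ).eval (n : ℝ) * νS n :=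
      funext fun n => by push_cast; simp
    rw [e]
    exact h
  -- eventual hypotheses: the stage clauses, the regime, `n ≥ 1`, `ε n ≤ e^{-π}`
  have hεπ : ∀ᶠ n : ℕ in atTop, ε n ≤ Real.exp (-Real.pi) := by
    have h0 := hε 0
    simp only [pow_zero, one_mul] at h0
    exact (h0.eventually (ge_mem_nhds (Real.exp_pos _))).mono fun n hn => hn
  rw [UniformQCircuitFamily.samplesDGS_iff]
  filter_upwards [hst, hreg, eventually_ge_atTop 1, hεπ] with n hstn hregn hn1 hεn I r hIn hI hφ
  subst hIn
  obtain ⟨hα0, hα1, hαq⟩ := hregn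
  set x : List Bool := GapSVPInstance.encode (I, r) with hx
  obtain ⟨hboot, hstep⟩ := hstn I r x rfl hI hx
  have hn : 0 < I.n := hn1
  have hθn : α I.n * q I.n / Real.sqrt I.n ≤ θ I.n := hθ I.n hn
  have hη : 0 ≤ smoothingParameter I.lattice (ε I.n) := smoothingParameter_nonneg _ _
  have hφ' : Real.sqrt (2 * I.n) * smoothingParameter I.lattice (ε I.n) / α I.n < r := hφ
  have hnx : I.n ≤ x.length := n_le_length_encode_pair I r
  -- notation for the invariant
  set mm := mS.eval x.length with hmm
  set readE := readBatchE (encB I.n) with hreadE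
  set ideal : ℕ → PMF (Option (Fin (N I.n) → EuclideanSpace ℝ (Fin I.n))) :=
    fun k => idealBatch I (N I.n) (levelRadius (θ I.n) (3 * I.n) r k) with hideal
  set a : ℕ → ℝ := fun k => ((chainLaw 0 S.family mm x (k + 1)).map readE).tvDist (ideal k) with ha
  set c : ℕ → ℝ := fun k => if k < 3 * I.n then νS I.n else 0 with hc
  -- admissibility of the paying stages
  have ha0 : a 0 ≤ νS I.n :=
    hboot (two_pow_mul_successiveMinimum_lt_levelRadius_zero hI hn hα0 hα1 hαq (hε0 I.n) hεn hθn
      hφ' le_rfl)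
  have hstep' : ∀ k < 3 * x.length, a (k + 1) ≤ a k + c k := fun k hk =>
    hstep k hk fun hk3 => sqrt_two_mul_lt_levelRadius hα0 hn hαq hθn hη hφ' hk3
  -- the invariant at the end: `3|x| + 1` stages, radius `ρ_{3|x|} = r`, cost `(3n+1) ν_S`
  have hinv := le_add_sum_of_succ_le ha0 hstep' le_rfl
  rw [hc, sum_range_ite_lt (νS I.n) (by omega : 3 * I.n ≤ 3 * x.length)] at hinv
  have hend : levelRadius (θ I.n) (3 * I.n) r (3 * x.length) = r := by
    rw [levelRadius, Nat.sub_eq_zero_of_le (by omega), pow_zero, one_mul]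
  have hinv' : ((chainLaw 0 S.family mm x (3 * x.length + 1)).map readE).tvDist (idealBatch I (N I.n) r) ≤
      (3 * I.n + 1 : ℕ) * νS I.n := by
    have h := hinv
    simp only [ha, hideal, hend] at h
    push_cast at h ⊢
    linarith
  -- read-out: compare the two laws event by event
  set ideal1 : PMF (EuclideanSpace ℝ (Fin I.n)) :=
    (discreteGaussian I.lattice (r : ℝ) 0).map Subtype.val with hideal1
  set P := (chainLaw 0 S.family mm x (3 * x.length + 1)).map readE with hP
  have hNn := hN I.n
  rw [PMF.tvDist_comm, PMF.tvDist_eq_iSup_measure_holds]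
  refine ciSup_le fun A => ?_
  -- the event on batches: "the first vector lies in `A`"
  set SA : Set (Option (Fin (N I.n) → EuclideanSpace ℝ (Fin I.n))) :=
    {o | ∃ B, o = some B ∧ B ⟨0, hNn⟩ ∈ A} with hSA
  have hpre : some ⁻¹' SA = (fun B : Fin (N I.n) → EuclideanSpace ℝ (Fin I.n) => B ⟨0, hNn⟩) ⁻¹' A := by
    ext B; simp [hSA]
  have hidealA : (idealBatch I (N I.n) r).toOuterMeasure SA = ideal1.toOuterMeasure A := by
    rw [idealBatch, PMF.toOuterMeasure_map_apply some _ SA, hpre,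
      ← PMF.toOuterMeasure_map_apply (fun B : Fin (N I.n) → EuclideanSpace ℝ (Fin I.n) => B ⟨0, hNn⟩) _ A,
      iidPMF_map_eval]
  -- the ideal probability is within `(3n+1) ν_S` of the chain's
  have h1 : ((idealBatch I (N I.n) r).toOuterMeasure SA).toReal - (P.toOuterMeasure SA).toReal ≤
      (3 * I.n + 1 : ℕ) * νS I.n := by
    refine (PMF.toReal_toOuterMeasure_sub_le_tvDist _ _ SA).trans ?_
    rw [PMF.tvDist_comm]
    exact hinv'
  -- the chain's probability is below `D`'s (prefix relation and the reader)
  set E : Set (List Bool) := readE ⁻¹' SA with hE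
  have h2 : P.toOuterMeasure SA = (chainLaw 0 S.family mm x (3 * x.length + 1)).toOuterMeasure E := by
    rw [hP, PMF.toOuterMeasure_map_apply]
  have h3 : (chainLaw 0 S.family mm x (3 * x.length + 1)).toOuterMeasure E ≤
      (D.kernel x).toOuterMeasure {z | ∃ y ∈ E, y <+: z} := by
    have h := hD x E
    rwa [hTe] at h
  have h4 : (D.kernel x).toOuterMeasure {z | ∃ y ∈ E, y <+: z} ≤
      (D.outputVectorLaw I.n x).toOuterMeasure A := by
    rw [UniformQCircuitFamily.outputVectorLaw, PMF.toOuterMeasure_map_apply]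
    refine (D.kernel x).toOuterMeasure.mono ?_
    rintro z ⟨y, hy, hyz⟩
    -- `y` reads a batch whose first vector lies in `A`; so does every extension `z` of `y`
    have hy' : readE y ∈ SA := hy
    rw [hSA, Set.mem_setOf_eq] at hy'
    obtain ⟨B, hB, hBA⟩ := hy'
    rw [hreadE, readBatchE] at hB
    cases hb : readFront (encB I.n) y with
    | none => rw [hb] at hB; exact absurd hB (by simp)
    | some b =>
      rw [hb, Option.map_some, Option.some.injEq] at hB
      subst hB
      obtain ⟨w, rfl⟩ := (prefix_of_readFront_eq_some _ hb).trans hyz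
      show intVecToEuclidean I.n (decodeLatticeVector I.n (encB I.n b ++ w)) ∈ A
      rw [hdec I.n b w ⟨0, hNn⟩ rfl]
      exact hBA
  -- assemble
  have hfin : (D.outputVectorLaw I.n x).toOuterMeasure A ≠ ∞ :=
    ne_top_of_le_ne_top ENNReal.one_ne_top
      (((D.outputVectorLaw I.n x).toOuterMeasure.mono (Set.subset_univ _)).trans_eq
        (((D.outputVectorLaw I.n x).toOuterMeasure_apply_eq_one_iff Set.univ).2 (Set.subset_univ _)))
  have h34 : (P.toOuterMeasure SA).toReal ≤ ((D.outputVectorLaw I.n x).toOuterMeasure A).toReal := by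
    rw [h2]
    exact ENNReal.toReal_mono hfin (h3.trans h4)
  rw [← hidealA]
  push_cast at h1 ⊢
  linarith

end MainTheorem

end Regev2009

/-! ### pqc.S19 from the loop principle, the stage family, and Lemma 3.17 / Lemma 3.20 -/

section Corollaries

variable (q : ℕ → ℕ) [∀ n, NeZero (q n)] (α : ℕ → ℝ) (m : ℕ → ℕ)

/-- **pqc.S19 (SIVP form) from the loop principle, the stage family of Thm 3.1, and Lemma 3.17.**
`regev_lwe_to_sivp_quantum_of_thm31_of_lemma317` with `h₂ := Regev2009.thm_3_1_machine_of_stages`.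
[cite: Regev2009, Thm 1.1 from Thm 3.1 (proof) and Lemma 3.17] -/
theorem regev_lwe_to_sivp_quantum_of_stages_of_lemma317
    (hLoop : ∀ (S : UniformQCircuitFamily) (T m : Polynomial ℕ), ∃ D : UniformQCircuitFamily,
      ∀ (x : List Bool) (E : Set (List Bool)),
        (chainLaw 0 S.family (m.eval x.length) x (T.eval x.length)).toOuterMeasure E ≤
          (D.kernel x).toOuterMeasure {z | ∃ y ∈ E, y <+: z})
    (hStage : ∀ (m : ℕ → ℕ) (_ : IsPolyBounded m) (_ : IsPolyTimeParams q α m)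
      (_ : ∀ᶠ n : ℕ in atTop, 0 < α n ∧ α n < 1 ∧ 2 * Real.sqrt n < α n * q n)
      (_ : ∃ (W : UniformQCircuitFamily) (c : ℝ), 0 < c ∧
        W.SolvesSearchLWEWorstCase q (fun n => discretizedGaussian (q n) (α n)) m
          fun n => (2 : ℝ) ^ (-(c * n)))
      (ε : ℕ → ℝ), IsNegligible ε → (∀ n, 0 < ε n) →
      ∃ (S : UniformQCircuitFamily) (N : ℕ → ℕ) (mS : Polynomial ℕ)
        (encB : (n : ℕ) → (Fin (N n) → Fin n → ℤ) → List Bool) (νS : ℕ → ℝ) (θ : ℕ → ℝ),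
        IsNegligible νS ∧ (∀ n, 0 < n → α n * q n / Real.sqrt n ≤ θ n) ∧
        (∀ n (b b' : Fin (N n) → Fin n → ℤ) (z : List Bool), encB n b <+: z → encB n b' <+: z → b = b') ∧
        (∀ n (b : Fin (N n) → Fin n → ℤ) (w : List Bool) (j : Fin (N n)), (j : ℕ) = 0 →
          decodeLatticeVector n (encB n b ++ w) = b j) ∧
        (∀ n, 0 < N n) ∧
        ∀ᶠ n : ℕ in atTop, ∀ (I : LatticeInstance) (r : ℚ) (x : List Bool), I.n = n → I.IsNonsingular →
          x = GapSVPInstance.encode (I, r) →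
          ((2 : ℝ) ^ (2 * I.n) * successiveMinimum I.lattice I.n < Regev2009.levelRadius (θ I.n) (3 * I.n) r 0 →
            ((chainLaw 0 S.family (mS.eval x.length) x 1).map (Regev2009.readBatchE (encB I.n))).tvDist
              (Regev2009.idealBatch I (N I.n) (Regev2009.levelRadius (θ I.n) (3 * I.n) r 0)) ≤ νS I.n) ∧
          (∀ k, k < 3 * x.length →
            (k < 3 * I.n → Real.sqrt 2 * q I.n * smoothingParameter I.lattice (ε I.n) <
              Regev2009.levelRadius (θ I.n) (3 * I.n) r k) →
            ((chainLaw 0 S.family (mS.eval x.length) x (k + 2)).map (Regev2009.readBatchE (encB I.n))).tvDist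
                (Regev2009.idealBatch I (N I.n) (Regev2009.levelRadius (θ I.n) (3 * I.n) r (k + 1))) ≤
              ((chainLaw 0 S.family (mS.eval x.length) x (k + 1)).map (Regev2009.readBatchE (encB I.n))).tvDist
                  (Regev2009.idealBatch I (N I.n) (Regev2009.levelRadius (θ I.n) (3 * I.n) r k)) +
                if k < 3 * I.n then νS I.n else 0))
    (h₃ : ∀ (ε : ℕ → ℝ) (φ : LatticeInstance → ℝ), (∀ n, 0 < ε n ∧ ε n ≤ 1 / 10) →
      (∀ᶠ n in atTop, ∀ I : LatticeInstance, I.n = n → I.IsNonsingular →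
        Real.sqrt 2 * smoothingParameter I.lattice (ε n) ≤ φ I) →
      ∀ (D : UniformQCircuitFamily) (ν : ℕ → ℝ), IsNegligible ν → D.SamplesDGS φ ν →
        ∃ G : UniformQCircuitFamily, G.SolvesGIVP fun I => 2 * Real.sqrt I.n * φ I) :
    regev_lwe_to_sivp_quantum q α m :=
  regev_lwe_to_sivp_quantum_of_thm31_of_lemma317 q α m
    (Regev2009.thm_3_1_machine_of_stages q α hLoop hStage) h₃

/-- **pqc.S19 (GapSVP form) from the loop principle, the stage family of Thm 3.1, and Lemma 3.20.**
`regev_lwe_to_gapSVP_quantum_of_thm31_of_lemma320` with `h₂ := Regev2009.thm_3_1_machine_of_stages`.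
[cite: Regev2009, Thm 1.1 from Thm 3.1 (proof), Lemma 3.20 and §3.3 (GMSS99)] -/
theorem regev_lwe_to_gapSVP_quantum_of_stages_of_lemma320
    (hLoop : ∀ (S : UniformQCircuitFamily) (T m : Polynomial ℕ), ∃ D : UniformQCircuitFamily,
      ∀ (x : List Bool) (E : Set (List Bool)),
        (chainLaw 0 S.family (m.eval x.length) x (T.eval x.length)).toOuterMeasure E ≤
          (D.kernel x).toOuterMeasure {z | ∃ y ∈ E, y <+: z})
    (hStage : ∀ (m : ℕ → ℕ) (_ : IsPolyBounded m) (_ : IsPolyTimeParams q α m)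
      (_ : ∀ᶠ n : ℕ in atTop, 0 < α n ∧ α n < 1 ∧ 2 * Real.sqrt n < α n * q n)
      (_ : ∃ (W : UniformQCircuitFamily) (c : ℝ), 0 < c ∧
        W.SolvesSearchLWEWorstCase q (fun n => discretizedGaussian (q n) (α n)) m
          fun n => (2 : ℝ) ^ (-(c * n)))
      (ε : ℕ → ℝ), IsNegligible ε → (∀ n, 0 < ε n) →
      ∃ (S : UniformQCircuitFamily) (N : ℕ → ℕ) (mS : Polynomial ℕ)
        (encB : (n : ℕ) → (Fin (N n) → Fin n → ℤ) → List Bool) (νS : ℕ → ℝ) (θ : ℕ → ℝ),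
        IsNegligible νS ∧ (∀ n, 0 < n → α n * q n / Real.sqrt n ≤ θ n) ∧
        (∀ n (b b' : Fin (N n) → Fin n → ℤ) (z : List Bool), encB n b <+: z → encB n b' <+: z → b = b') ∧
        (∀ n (b : Fin (N n) → Fin n → ℤ) (w : List Bool) (j : Fin (N n)), (j : ℕ) = 0 →
          decodeLatticeVector n (encB n b ++ w) = b j) ∧
        (∀ n, 0 < N n) ∧
        ∀ᶠ n : ℕ in atTop, ∀ (I : LatticeInstance) (r : ℚ) (x : List Bool), I.n = n → I.IsNonsingular →
          x = GapSVPInstance.encode (I, r) →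
          ((2 : ℝ) ^ (2 * I.n) * successiveMinimum I.lattice I.n < Regev2009.levelRadius (θ I.n) (3 * I.n) r 0 →
            ((chainLaw 0 S.family (mS.eval x.length) x 1).map (Regev2009.readBatchE (encB I.n))).tvDist
              (Regev2009.idealBatch I (N I.n) (Regev2009.levelRadius (θ I.n) (3 * I.n) r 0)) ≤ νS I.n) ∧
          (∀ k, k < 3 * x.length →
            (k < 3 * I.n → Real.sqrt 2 * q I.n * smoothingParameter I.lattice (ε I.n) <
              Regev2009.levelRadius (θ I.n) (3 * I.n) r k) →
            ((chainLaw 0 S.family (mS.eval x.length) x (k + 2)).map (Regev2009.readBatchE (encB I.n))).tvDist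
                (Regev2009.idealBatch I (N I.n) (Regev2009.levelRadius (θ I.n) (3 * I.n) r (k + 1))) ≤
              ((chainLaw 0 S.family (mS.eval x.length) x (k + 1)).map (Regev2009.readBatchE (encB I.n))).tvDist
                  (Regev2009.idealBatch I (N I.n) (Regev2009.levelRadius (θ I.n) (3 * I.n) r k)) +
                if k < 3 * I.n then νS I.n else 0))
    (hL : ∀ (γ : ℕ → ℝ), (∀ n, 1 ≤ γ n) →
      (∃ (D : UniformQCircuitFamily) (ν : ℕ → ℝ),
          IsNegligible ν ∧ D.SamplesDGS (Regev2009.dgsBoundDual γ) ν) →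
      ∃ Q : UniformQCircuitFamily, ∀ᶠ n : ℕ in atTop, ∀ p : GapCVPInstance, p.1.I.n = n →
        (p ∈ GapCVP'.yes (fun k => 100 * Real.sqrt k * γ k) → 2 / 3 ≤ Q.acceptProb p.encode) ∧
        (p ∈ GapCVP'.no (fun k => 100 * Real.sqrt k * γ k) → Q.acceptProb p.encode ≤ 1 / 3)) :
    regev_lwe_to_gapSVP_quantum q α m :=
  regev_lwe_to_gapSVP_quantum_of_thm31_of_lemma320 q α m
    (Regev2009.thm_3_1_machine_of_stages q α hLoop hStage) hL

end Corollaries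

end Literature.Computability.Cryptography

end
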